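import Mathlib
import Summits.ValiantsHypothesis.ValiantsHypothesis.Theses.ValuativeGCT
import Summits.ValiantsHypothesis.ValiantsHypothesis.Theorems.CutBites.Negative.NoCutInOddDegree

/-!
# `CutBites` — NON-VACUITY of the crux's truncation spaces (conventions certificate) and the
# boundary lemma "the obvious invariant never witnesses the cut"

Crux `stmt-ValiantsHypothesis-12626` (`Theses.ValuativeGCT.CutBites`, route ValuativeGCT).  Standing
disprover (cdisprove gen 2), `Cruxes/CutBites/Disproof.lean` §D, restated over the crux's literal
`let`-blocks (`m = n + 1 ≥ 1`, `λ = (mδ)` the one-row partition `Nat.Partition.indiscrete (mδ)`,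
`δ ≥ 1`).

* `cutBites_detRowLast_pow_mem_trunc_zero` — `det_m(last row of A)^δ ∈ T 0`: it is homogeneous of
  degree `mδ`, invariant under the `End`-stabiliser of `det_m` by the hypothesis `linSubst M det_m =
  det_m` ALONE (`aeval_rowAct_rename`: pull-back-type forms need no Frobenius), and a `B`-eigenvector
  of weight `((mδ))* = (dualOfPartition (m*m) (mδ)).toMatIdx`, whose only non-zero entry is `-mδ` at
  the LAST index of `MatIdx m` in the lexicographic order (`dualOfPartition_indiscrete_toMatIdx_apply`,
  `weightChar_oneRow`).  Hence `cutBites_trunc_zero_ne_bot`: `T 0 ≠ ⊥` — the route's weight / dual /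
  Borel / `g⁻¹` conventions are consistent (a vacuous `T 0` would have made `CutBites` trivially
  false and `ValuativeBound` vacuous).
* `cutBites_detRowLast_pow_mem_trunc_delta_of_odd` — for ODD `m` the same element lies in `T δ`
  (`det_m` vanishes on odd skew matrices, so `det^δ ∈ P_Λ^δ`): `T δ ≠ ⊥` as well, and this element
  never witnesses `T δ < T 0` (boundary lemma; with `NoCutInOddDegree` it pins what a witness must be:
  a non-pull-back invariant of EVEN degree `mδ`, `δ ≥ 2`).
[folklore]
-/

namespace Summit.ValiantsHypothesis.ValiantsHypothesis.Theorems.CutBites.Negative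

open Literature.NumberTheory.DiophantineGeometry Literature.Computability.AlgebraicComplexity
open MvPolynomial
open scoped BigOperators Matrix

noncomputable section

variable {n : ℕ}

/-! ### Stabiliser factor -/

/-- TEMPLATE: the row action `A ↦ A M` intertwines `rename (j, ·)` with `linSubst M`. [folklore] -/
theorem aeval_rowAct_rename {m : ℕ} (M : Matrix (MatIdx m) (MatIdx m) ℂ) (j : MatIdx m)
    (q : MvPolynomial (MatIdx m) ℂ) :
    MvPolynomial.aeval (R := ℂ) (fun p : MatIdx m × MatIdx m =>
        ∑ l : MatIdx m, M l p.2 • MvPolynomial.X (p.1, l)) (rename (fun i : MatIdx m => (j, i)) q)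
      = rename (fun i : MatIdx m => (j, i)) (linSubst (MatIdx m) ℂ M q) := by
  rw [aeval_rename]
  have : (rename (fun i : MatIdx m => (j, i))).comp (linSubst (MatIdx m) ℂ M)
      = MvPolynomial.aeval (R := ℂ) ((fun p : MatIdx m × MatIdx m =>
          ∑ l : MatIdx m, M l p.2 • MvPolynomial.X (p.1, l)) ∘ fun i : MatIdx m => (j, i)) := by
    refine MvPolynomial.algHom_ext fun i => ?_
    simp [linSubst_X, map_sum, rename_X]
  exact (AlgHom.congr_fun this q).symm

/-! ### Borel factor: the last index, rescaling of homogeneous forms, the one-row weight -/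

/-- Rescaling the variables of a homogeneous form. [folklore] -/
theorem aeval_smul_X_of_isHomogeneous {σ τ : Type*} {φ : MvPolynomial σ ℂ} {k : ℕ}
    (hφ : φ.IsHomogeneous k) (c : ℂ) (f : σ → τ) :
    MvPolynomial.aeval (R := ℂ) (fun i => c • (X (f i) : MvPolynomial τ ℂ)) φ
      = C (c ^ k) * rename f φ := by
  have hre : (rename f : MvPolynomial σ ℂ →ₐ[ℂ] MvPolynomial τ ℂ)
      = MvPolynomial.aeval (R := ℂ) (fun i => (X (f i) : MvPolynomial τ ℂ)) :=
    MvPolynomial.algHom_ext fun i => by rw [rename_X, aeval_X]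
  rw [show rename f φ = _ from AlgHom.congr_fun hre φ]
  conv_lhs => rw [φ.as_sum]
  conv_rhs => rw [φ.as_sum]
  rw [map_sum, map_sum, Finset.mul_sum]
  refine Finset.sum_congr rfl fun d hd => ?_
  have hdeg : (∑ i ∈ d.support, d i) = k := by
    have := hφ (mem_support_iff.mp hd)
    simpa [Finsupp.weight_apply, Finsupp.sum] using this
  simp only [aeval_monomial, MvPolynomial.algebraMap_eq, smul_eq_C_mul, mul_pow, Finsupp.prod,
    Finset.prod_mul_distrib, ← map_pow, ← map_prod, Finset.prod_pow_eq_pow_sum, hdeg]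
  ring

/-- The last index `(m-1, m-1)` of `MatIdx m` (`m = n + 1`) is the top of the lex order. [folklore] -/
theorem le_matIdxEquiv_rev_zero (l : MatIdx (n + 1)) : l ≤ (matIdxEquiv (n + 1) (Fin.rev 0)) := by
  rw [← (matIdxEquiv (n + 1)).apply_symm_apply l, (matIdxEquiv (n + 1)).le_iff_le,
    Fin.le_iff_val_le_val, Fin.val_rev]
  have := ((matIdxEquiv (n + 1)).symm l).isLt
  simp only [Fin.val_zero, zero_add]
  exact Nat.le_sub_one_of_lt this

/-- The inverse of an upper-triangular invertible matrix is upper triangular. [folklore] -/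
theorem isUpperTriangular_inv' {k : ℕ} {g : Matrix.GeneralLinearGroup (MatIdx k) ℂ}
    (hg : IsUpperTriangular g) : IsUpperTriangular g⁻¹ :=
  (mem_borelSubgroup_iff _).mp ((borelSubgroup _ ℂ).inv_mem ((mem_borelSubgroup_iff _).mpr hg))

/-- For upper-triangular `g`, row `last` of `g⁻¹` is supported on the diagonal. [folklore] -/
theorem inv_last_apply_eq_zero {g : Matrix.GeneralLinearGroup (MatIdx (n + 1)) ℂ}
    (hg : IsUpperTriangular g) {l : MatIdx (n + 1)} (hl : l ≠ (matIdxEquiv (n + 1) (Fin.rev 0))) :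
    ((g⁻¹ : Matrix.GeneralLinearGroup (MatIdx (n + 1)) ℂ) : Matrix (MatIdx (n + 1)) (MatIdx (n + 1)) ℂ) (matIdxEquiv (n + 1) (Fin.rev 0)) l = 0 :=
  (isUpperTriangular_inv' hg).apply_eq_zero (lt_of_le_of_ne (le_matIdxEquiv_rev_zero l) hl)

/-- Diagonal entries of `g⁻¹` and `g` at the last index are mutually inverse. [folklore] -/
theorem inv_last_mul_last {g : Matrix.GeneralLinearGroup (MatIdx (n + 1)) ℂ} (hg : IsUpperTriangular g) :
    ((g⁻¹ : Matrix.GeneralLinearGroup (MatIdx (n + 1)) ℂ) : Matrix (MatIdx (n + 1)) (MatIdx (n + 1)) ℂ) (matIdxEquiv (n + 1) (Fin.rev 0)) (matIdxEquiv (n + 1) (Fin.rev 0)) * (g : Matrix (MatIdx (n + 1)) (MatIdx (n + 1)) ℂ) (matIdxEquiv (n + 1) (Fin.rev 0)) (matIdxEquiv (n + 1) (Fin.rev 0)) = 1 := by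
  have h := diag_mul_of_isUpperTriangular (isUpperTriangular_inv' hg) hg (matIdxEquiv (n + 1) (Fin.rev 0))
  rw [inv_mul_cancel, Units.val_one, Matrix.one_apply_eq] at h
  exact h.symm

/-- TEMPLATE: the Borel action `G ↦ G(g⁻¹A)` on `det_m(last row)` is a rescaling. [folklore] -/
theorem aeval_borelAct_detRowLast {g : Matrix.GeneralLinearGroup (MatIdx (n + 1)) ℂ}
    (hg : IsUpperTriangular g) :
    MvPolynomial.aeval (R := ℂ) (fun p : MatIdx (n + 1) × MatIdx (n + 1) =>
        ∑ l : MatIdx (n + 1), ((g⁻¹ : Matrix.GeneralLinearGroup (MatIdx (n + 1)) ℂ) : Matrix (MatIdx (n + 1)) (MatIdx (n + 1)) ℂ) p.1 l • MvPolynomial.X (l, p.2)) (rename (fun i : MatIdx (n + 1) => ((matIdxEquiv (n + 1) (Fin.rev 0)), i)) (detFormLex ℂ (n + 1)))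
      = C ((((g⁻¹ : Matrix.GeneralLinearGroup (MatIdx (n + 1)) ℂ) : Matrix (MatIdx (n + 1)) (MatIdx (n + 1)) ℂ) (matIdxEquiv (n + 1) (Fin.rev 0)) (matIdxEquiv (n + 1) (Fin.rev 0))) ^ (n + 1)) * (rename (fun i : MatIdx (n + 1) => ((matIdxEquiv (n + 1) (Fin.rev 0)), i)) (detFormLex ℂ (n + 1))) := by
  rw [aeval_rename]
  have : ((fun p : MatIdx (n + 1) × MatIdx (n + 1) =>
        ∑ l : MatIdx (n + 1), ((g⁻¹ : Matrix.GeneralLinearGroup (MatIdx (n + 1)) ℂ) : Matrix (MatIdx (n + 1)) (MatIdx (n + 1)) ℂ) p.1 l • (MvPolynomial.X (l, p.2) : MvPolynomial (MatIdx (n + 1) × MatIdx (n + 1)) ℂ))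
          ∘ fun i : MatIdx (n + 1) => ((matIdxEquiv (n + 1) (Fin.rev 0)), i))
      = fun i => (((g⁻¹ : Matrix.GeneralLinearGroup (MatIdx (n + 1)) ℂ) : Matrix (MatIdx (n + 1)) (MatIdx (n + 1)) ℂ) (matIdxEquiv (n + 1) (Fin.rev 0)) (matIdxEquiv (n + 1) (Fin.rev 0))) • (X ((fun i : MatIdx (n + 1) => ((matIdxEquiv (n + 1) (Fin.rev 0)), i)) i) :
              MvPolynomial (MatIdx (n + 1) × MatIdx (n + 1)) ℂ) := by
    funext i
    refine Finset.sum_eq_single (matIdxEquiv (n + 1) (Fin.rev 0)) (fun l _ hl => ?_) (fun h => absurd (Finset.mem_univ _) h)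
    rw [inv_last_apply_eq_zero hg hl, zero_smul]
  rw [this, aeval_smul_X_of_isHomogeneous (detFormLex_isHomogeneous ℂ (n + 1))]

/-- The sorted parts of the one-row partition `(D)`. [folklore] -/
theorem sortedParts_indiscrete {D : ℕ} (hD : D ≠ 0) :
    (Nat.Partition.indiscrete D).sortedParts = [D] := by
  rw [Nat.Partition.sortedParts, Nat.Partition.indiscrete_parts hD, Multiset.sort_singleton]

/-- **The crux's weight at the one-row partition**: `((mδ))*` is `-mδ` at the LAST lex index and
`0` elsewhere (route conventions `dualOfPartition` / `toMatIdx`, in Lean). [folklore] -/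
theorem dualOfPartition_indiscrete_toMatIdx_apply {δ : ℕ} (hδ : 0 < δ) (ij : MatIdx (n + 1)) :
    (Weight.dualOfPartition ((n + 1) * (n + 1)) (Nat.Partition.indiscrete ((n + 1) * δ))).toMatIdx ij = if ij = (matIdxEquiv (n + 1) (Fin.rev 0)) then -(((n + 1) * δ : ℕ) : ℤ) else 0 := by
  have hD : (n + 1) * δ ≠ 0 := by positivity
  simp only [Weight.toMatIdx, Weight.dualOfPartition, Weight.dual, Weight.ofPartition,
    sortedParts_indiscrete hD]
  by_cases h : ij = (matIdxEquiv (n + 1) (Fin.rev 0))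
  · subst h
    rw [if_pos rfl, OrderIso.symm_apply_apply, Fin.rev_rev]
    simp
  · rw [if_neg h]
    have hne : Fin.rev ((matIdxEquiv (n + 1)).symm ij) ≠ 0 := by
      intro h0
      apply h
      rw [Fin.rev_eq_iff] at h0
      rw [← h0, OrderIso.apply_symm_apply]
    have hv : ((Fin.rev ((matIdxEquiv (n + 1)).symm ij) : Fin ((n + 1) * (n + 1))) : ℕ) ≠ 0 := by
      intro h0
      exact hne (Fin.ext (by rw [h0, Fin.val_zero]))
    obtain ⟨k, hk⟩ := Nat.exists_eq_succ_of_ne_zero hv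
    rw [hk, List.getD_cons_succ, List.getD_nil]
    simp

/-- The weight character of `((mδ))*` on the Borel: `g ↦ (g_last,last)^(-mδ)`. [folklore] -/
theorem weightChar_oneRow {δ : ℕ} (hδ : 0 < δ) (g : Matrix.GeneralLinearGroup (MatIdx (n + 1)) ℂ) :
    weightChar (Weight.dualOfPartition ((n + 1) * (n + 1)) (Nat.Partition.indiscrete ((n + 1) * δ))).toMatIdx g
      = ((g : Matrix (MatIdx (n + 1)) (MatIdx (n + 1)) ℂ) (matIdxEquiv (n + 1) (Fin.rev 0)) (matIdxEquiv (n + 1) (Fin.rev 0))) ^ (-(((n + 1) * δ : ℕ) : ℤ)) := by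
  rw [weightChar, Finset.prod_eq_single (matIdxEquiv (n + 1) (Fin.rev 0))]
  · rw [dualOfPartition_indiscrete_toMatIdx_apply hδ, if_pos rfl]
  · intro i _ hi
    rw [dualOfPartition_indiscrete_toMatIdx_apply hδ, if_neg hi, zpow_zero]
  · intro h
    exact absurd (Finset.mem_univ _) h

/-- `det_m(last row)^δ` is a `B`-eigenvector of weight `((mδ))*`. [folklore] -/
theorem aeval_borelAct_detRowLast_pow {δ : ℕ} (hδ : 0 < δ)
    {g : Matrix.GeneralLinearGroup (MatIdx (n + 1)) ℂ} (hg : IsUpperTriangular g) :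
    MvPolynomial.aeval (R := ℂ) (fun p : MatIdx (n + 1) × MatIdx (n + 1) =>
        ∑ l : MatIdx (n + 1), ((g⁻¹ : Matrix.GeneralLinearGroup (MatIdx (n + 1)) ℂ) : Matrix (MatIdx (n + 1)) (MatIdx (n + 1)) ℂ) p.1 l • MvPolynomial.X (l, p.2)) ((rename (fun i : MatIdx (n + 1) => ((matIdxEquiv (n + 1) (Fin.rev 0)), i)) (detFormLex ℂ (n + 1))) ^ δ)
      = weightChar (Weight.dualOfPartition ((n + 1) * (n + 1)) (Nat.Partition.indiscrete ((n + 1) * δ))).toMatIdx g • (rename (fun i : MatIdx (n + 1) => ((matIdxEquiv (n + 1) (Fin.rev 0)), i)) (detFormLex ℂ (n + 1))) ^ δ := by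
  rw [map_pow, aeval_borelAct_detRowLast hg, mul_pow, ← map_pow, ← pow_mul, weightChar_oneRow hδ,
    smul_eq_C_mul, zpow_neg, zpow_natCast]
  congr 2
  rw [← inv_pow, ← eq_inv_of_mul_eq_one_left (inv_last_mul_last hg)]

/-! ### Vanishing on the skew locus for odd `m` -/

/-- For odd `m`, `det_m(row j)` vanishes at every point all of whose rows are skew. [folklore] -/
theorem aeval_detRow_eq_zero_of_odd (hm : Odd (n + 1)) (j : MatIdx (n + 1)) {p : MatIdx (n + 1) × MatIdx (n + 1) → ℂ}
    (hp : ∀ j' : MatIdx (n + 1), (fun i => p (j', i)) ∈ Submodule.span ℂ {u : MatIdx (n + 1) → ℂ | ∀ a b : Fin (n + 1), u (toLex (a, b)) = -u (toLex (b, a))}) :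
    MvPolynomial.aeval (R := ℂ) p (rename (fun i : MatIdx (n + 1) => (j, i)) (detFormLex ℂ (n + 1))) = 0 := by
  rw [aeval_rename, detFormLex, aeval_rename]
  have hdet : MvPolynomial.aeval (R := ℂ) ((p ∘ fun i : MatIdx (n + 1) => (j, i)) ∘ toLex)
      (detPoly (Fin (n + 1)) ℂ) = (Matrix.of fun a b : Fin (n + 1) => p (j, toLex (a, b))).det := by
    rw [detPoly, AlgHom.map_det]
    congr 1
    ext a b
    simp [Matrix.mvPolynomialX]
  rw [hdet]
  set S : Matrix (Fin (n + 1)) (Fin (n + 1)) ℂ := Matrix.of fun a b => p (j, toLex (a, b)) with hSdef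
  have hS : Sᵀ = -S := by
    ext a b
    simp only [Matrix.transpose_apply, Matrix.neg_apply, hSdef, Matrix.of_apply]
    exact skew_of_mem_span_skew (hp j) b a
  have h1 : S.det = (-1) ^ (n + 1) * S.det := by
    conv_lhs => rw [← Matrix.det_transpose, hS, Matrix.det_neg]
    rw [Fintype.card_fin]
  rw [hm.neg_one_pow] at h1
  linear_combination h1 / 2

/-! ### The certificates, over the crux's literal `let`-blocks -/

/-- **Membership.** `det_m(last row)^δ ∈ T 0` at `λ = (mδ)` (`m = n + 1`, `δ ≥ 1`). [folklore] -/
theorem cutBites_detRowLast_pow_mem_trunc_zero (n δ : ℕ) (hδ : 0 < δ) :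
    (let U : Submodule ℂ (MatIdx (n + 1) → ℂ) :=
        Submodule.span ℂ {u : MatIdx (n + 1) → ℂ | ∀ a b : Fin (n + 1), u (toLex (a, b)) = -u (toLex (b, a))};
      let χ : Weight (MatIdx (n + 1)) := (Weight.dualOfPartition ((n + 1) * (n + 1)) (Nat.Partition.indiscrete ((n + 1) * δ))).toMatIdx;
      let T : ℕ → Submodule ℂ (MvPolynomial (MatIdx (n + 1) × MatIdx (n + 1)) ℂ) := fun t =>
        MvPolynomial.homogeneousSubmodule (MatIdx (n + 1) × MatIdx (n + 1)) ℂ ((n + 1) * δ)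
        ⊓ ((MvPolynomial.vanishingIdeal ℂ {p : MatIdx (n + 1) × MatIdx (n + 1) → ℂ |
              ∀ j : MatIdx (n + 1), (fun i => p (j, i)) ∈ U}) ^ (t)).restrictScalars ℂ
        ⊓ (⨅ (M : Matrix (MatIdx (n + 1)) (MatIdx (n + 1)) ℂ)
            (_ : linSubst (MatIdx (n + 1)) ℂ M (detFormLex ℂ (n + 1)) = detFormLex ℂ (n + 1)),
            LinearMap.ker ((MvPolynomial.aeval (R := ℂ) fun p : MatIdx (n + 1) × MatIdx (n + 1) =>
              ∑ l : MatIdx (n + 1), M l p.2 • MvPolynomial.X (p.1, l)).toLinearMap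
              - LinearMap.id (R := ℂ) (M := MvPolynomial (MatIdx (n + 1) × MatIdx (n + 1)) ℂ)))
        ⊓ (⨅ (g : Matrix.GeneralLinearGroup (MatIdx (n + 1)) ℂ) (_ : IsUpperTriangular g),
            LinearMap.ker ((MvPolynomial.aeval (R := ℂ) fun p : MatIdx (n + 1) × MatIdx (n + 1) =>
              ∑ l : MatIdx (n + 1), ((g⁻¹ : Matrix.GeneralLinearGroup (MatIdx (n + 1)) ℂ) :
                Matrix (MatIdx (n + 1)) (MatIdx (n + 1)) ℂ) p.1 l • MvPolynomial.X (l, p.2)).toLinearMap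
              - weightChar χ g • LinearMap.id (R := ℂ) (M := MvPolynomial (MatIdx (n + 1) × MatIdx (n + 1)) ℂ)));
      (rename (fun i : MatIdx (n + 1) => ((matIdxEquiv (n + 1) (Fin.rev 0)), i)) (detFormLex ℂ (n + 1))) ^ δ ∈ T 0) := by
  intro U χ T
  refine Submodule.mem_inf.mpr ⟨Submodule.mem_inf.mpr ⟨Submodule.mem_inf.mpr ⟨?_, ?_⟩, ?_⟩, ?_⟩
  · exact ((detFormLex_isHomogeneous ℂ (n + 1)).rename_isHomogeneous).pow δ
  · rw [Submodule.restrictScalars_mem, pow_zero, Ideal.one_eq_top]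
    exact Submodule.mem_top
  · refine (Submodule.mem_iInf _).mpr fun M => (Submodule.mem_iInf _).mpr fun hM => ?_
    rw [LinearMap.mem_ker, LinearMap.sub_apply, sub_eq_zero, AlgHom.toLinearMap_apply,
      LinearMap.id_coe, id_eq, map_pow, aeval_rowAct_rename, hM]
  · refine (Submodule.mem_iInf _).mpr fun g => (Submodule.mem_iInf _).mpr fun hg => ?_
    rw [LinearMap.mem_ker, LinearMap.sub_apply, sub_eq_zero, AlgHom.toLinearMap_apply,
      LinearMap.smul_apply, LinearMap.id_coe, id_eq]
    exact aeval_borelAct_detRowLast_pow hδ hg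

/-- The determinant form is non-zero. [folklore] -/
theorem detFormLex_ne_zero' (m : ℕ) : detFormLex ℂ m ≠ 0 := fun h =>
  Matrix.det_mvPolynomialX_ne_zero (m := Fin m) (R := ℂ)
    (rename_injective _ toLex.injective (h.trans (map_zero _).symm))

/-- `det_m(last row)^δ ≠ 0`. [folklore] -/
theorem detRowLast_pow_ne_zero (n δ : ℕ) : (rename (fun i : MatIdx (n + 1) => ((matIdxEquiv (n + 1) (Fin.rev 0)), i)) (detFormLex ℂ (n + 1))) ^ δ ≠ 0 :=
  pow_ne_zero δ fun h => detFormLex_ne_zero' (n + 1)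
    (rename_injective _ (Prod.mk_right_injective _) (h.trans (map_zero _).symm))

/-- **Non-vacuity / conventions certificate.** `T 0 ≠ ⊥` at `λ = (mδ)` for every `m ≥ 1`, `δ ≥ 1`:
the crux's weight convention (`dualOfPartition (m*m) λ` transported by `toMatIdx`, Borel acting by
`G ↦ G(g⁻¹A)`) does carry non-zero `Stab(det_m)`-invariant highest-weight vectors. [folklore] -/
theorem cutBites_trunc_zero_ne_bot (n δ : ℕ) (hδ : 0 < δ) :
    (let U : Submodule ℂ (MatIdx (n + 1) → ℂ) :=
        Submodule.span ℂ {u : MatIdx (n + 1) → ℂ | ∀ a b : Fin (n + 1), u (toLex (a, b)) = -u (toLex (b, a))};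
      let χ : Weight (MatIdx (n + 1)) := (Weight.dualOfPartition ((n + 1) * (n + 1)) (Nat.Partition.indiscrete ((n + 1) * δ))).toMatIdx;
      let T : ℕ → Submodule ℂ (MvPolynomial (MatIdx (n + 1) × MatIdx (n + 1)) ℂ) := fun t =>
        MvPolynomial.homogeneousSubmodule (MatIdx (n + 1) × MatIdx (n + 1)) ℂ ((n + 1) * δ)
        ⊓ ((MvPolynomial.vanishingIdeal ℂ {p : MatIdx (n + 1) × MatIdx (n + 1) → ℂ |
              ∀ j : MatIdx (n + 1), (fun i => p (j, i)) ∈ U}) ^ (t)).restrictScalars ℂ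
        ⊓ (⨅ (M : Matrix (MatIdx (n + 1)) (MatIdx (n + 1)) ℂ)
            (_ : linSubst (MatIdx (n + 1)) ℂ M (detFormLex ℂ (n + 1)) = detFormLex ℂ (n + 1)),
            LinearMap.ker ((MvPolynomial.aeval (R := ℂ) fun p : MatIdx (n + 1) × MatIdx (n + 1) =>
              ∑ l : MatIdx (n + 1), M l p.2 • MvPolynomial.X (p.1, l)).toLinearMap
              - LinearMap.id (R := ℂ) (M := MvPolynomial (MatIdx (n + 1) × MatIdx (n + 1)) ℂ)))
        ⊓ (⨅ (g : Matrix.GeneralLinearGroup (MatIdx (n + 1)) ℂ) (_ : IsUpperTriangular g),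
            LinearMap.ker ((MvPolynomial.aeval (R := ℂ) fun p : MatIdx (n + 1) × MatIdx (n + 1) =>
              ∑ l : MatIdx (n + 1), ((g⁻¹ : Matrix.GeneralLinearGroup (MatIdx (n + 1)) ℂ) :
                Matrix (MatIdx (n + 1)) (MatIdx (n + 1)) ℂ) p.1 l • MvPolynomial.X (l, p.2)).toLinearMap
              - weightChar χ g • LinearMap.id (R := ℂ) (M := MvPolynomial (MatIdx (n + 1) × MatIdx (n + 1)) ℂ)));
      T 0 ≠ ⊥) := by
  intro U χ T h
  have hmem : (rename (fun i : MatIdx (n + 1) => ((matIdxEquiv (n + 1) (Fin.rev 0)), i)) (detFormLex ℂ (n + 1))) ^ δ ∈ T 0 := cutBites_detRowLast_pow_mem_trunc_zero n δ hδ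
  rw [h, Submodule.mem_bot] at hmem
  exact detRowLast_pow_ne_zero n δ hmem

/-- **Boundary lemma.** For ODD `m` the same element lies in `T δ`: `det_m(last row)^δ ∈ T δ` at
`λ = (mδ)` — the obvious invariant never witnesses the cut. [folklore] -/
theorem cutBites_detRowLast_pow_mem_trunc_delta_of_odd (n δ : ℕ) (hm : Odd (n + 1)) (hδ : 0 < δ) :
    (let U : Submodule ℂ (MatIdx (n + 1) → ℂ) :=
        Submodule.span ℂ {u : MatIdx (n + 1) → ℂ | ∀ a b : Fin (n + 1), u (toLex (a, b)) = -u (toLex (b, a))};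
      let χ : Weight (MatIdx (n + 1)) := (Weight.dualOfPartition ((n + 1) * (n + 1)) (Nat.Partition.indiscrete ((n + 1) * δ))).toMatIdx;
      let T : ℕ → Submodule ℂ (MvPolynomial (MatIdx (n + 1) × MatIdx (n + 1)) ℂ) := fun t =>
        MvPolynomial.homogeneousSubmodule (MatIdx (n + 1) × MatIdx (n + 1)) ℂ ((n + 1) * δ)
        ⊓ ((MvPolynomial.vanishingIdeal ℂ {p : MatIdx (n + 1) × MatIdx (n + 1) → ℂ |
              ∀ j : MatIdx (n + 1), (fun i => p (j, i)) ∈ U}) ^ (t)).restrictScalars ℂ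
        ⊓ (⨅ (M : Matrix (MatIdx (n + 1)) (MatIdx (n + 1)) ℂ)
            (_ : linSubst (MatIdx (n + 1)) ℂ M (detFormLex ℂ (n + 1)) = detFormLex ℂ (n + 1)),
            LinearMap.ker ((MvPolynomial.aeval (R := ℂ) fun p : MatIdx (n + 1) × MatIdx (n + 1) =>
              ∑ l : MatIdx (n + 1), M l p.2 • MvPolynomial.X (p.1, l)).toLinearMap
              - LinearMap.id (R := ℂ) (M := MvPolynomial (MatIdx (n + 1) × MatIdx (n + 1)) ℂ)))
        ⊓ (⨅ (g : Matrix.GeneralLinearGroup (MatIdx (n + 1)) ℂ) (_ : IsUpperTriangular g),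
            LinearMap.ker ((MvPolynomial.aeval (R := ℂ) fun p : MatIdx (n + 1) × MatIdx (n + 1) =>
              ∑ l : MatIdx (n + 1), ((g⁻¹ : Matrix.GeneralLinearGroup (MatIdx (n + 1)) ℂ) :
                Matrix (MatIdx (n + 1)) (MatIdx (n + 1)) ℂ) p.1 l • MvPolynomial.X (l, p.2)).toLinearMap
              - weightChar χ g • LinearMap.id (R := ℂ) (M := MvPolynomial (MatIdx (n + 1) × MatIdx (n + 1)) ℂ)));
      (rename (fun i : MatIdx (n + 1) => ((matIdxEquiv (n + 1) (Fin.rev 0)), i)) (detFormLex ℂ (n + 1))) ^ δ ∈ T δ) := by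
  intro U χ T
  have h0 : (rename (fun i : MatIdx (n + 1) => ((matIdxEquiv (n + 1) (Fin.rev 0)), i)) (detFormLex ℂ (n + 1))) ^ δ ∈ T 0 := cutBites_detRowLast_pow_mem_trunc_zero n δ hδ
  obtain ⟨⟨⟨hH, -⟩, hS⟩, hW⟩ := h0
  refine Submodule.mem_inf.mpr ⟨Submodule.mem_inf.mpr ⟨Submodule.mem_inf.mpr ⟨hH, ?_⟩, hS⟩, hW⟩
  rw [Submodule.restrictScalars_mem]
  refine Ideal.pow_mem_pow ?_ δ
  rw [mem_vanishingIdeal_iff]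
  intro p hp
  exact aeval_detRow_eq_zero_of_odd hm _ hp

/-- For odd `m`, `T δ ≠ ⊥` at `λ = (mδ)` as well. [folklore] -/
theorem cutBites_trunc_delta_ne_bot_of_odd (n δ : ℕ) (hm : Odd (n + 1)) (hδ : 0 < δ) :
    (let U : Submodule ℂ (MatIdx (n + 1) → ℂ) :=
        Submodule.span ℂ {u : MatIdx (n + 1) → ℂ | ∀ a b : Fin (n + 1), u (toLex (a, b)) = -u (toLex (b, a))};
      let χ : Weight (MatIdx (n + 1)) := (Weight.dualOfPartition ((n + 1) * (n + 1)) (Nat.Partition.indiscrete ((n + 1) * δ))).toMatIdx;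
      let T : ℕ → Submodule ℂ (MvPolynomial (MatIdx (n + 1) × MatIdx (n + 1)) ℂ) := fun t =>
        MvPolynomial.homogeneousSubmodule (MatIdx (n + 1) × MatIdx (n + 1)) ℂ ((n + 1) * δ)
        ⊓ ((MvPolynomial.vanishingIdeal ℂ {p : MatIdx (n + 1) × MatIdx (n + 1) → ℂ |
              ∀ j : MatIdx (n + 1), (fun i => p (j, i)) ∈ U}) ^ (t)).restrictScalars ℂ
        ⊓ (⨅ (M : Matrix (MatIdx (n + 1)) (MatIdx (n + 1)) ℂ)
            (_ : linSubst (MatIdx (n + 1)) ℂ M (detFormLex ℂ (n + 1)) = detFormLex ℂ (n + 1)),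
            LinearMap.ker ((MvPolynomial.aeval (R := ℂ) fun p : MatIdx (n + 1) × MatIdx (n + 1) =>
              ∑ l : MatIdx (n + 1), M l p.2 • MvPolynomial.X (p.1, l)).toLinearMap
              - LinearMap.id (R := ℂ) (M := MvPolynomial (MatIdx (n + 1) × MatIdx (n + 1)) ℂ)))
        ⊓ (⨅ (g : Matrix.GeneralLinearGroup (MatIdx (n + 1)) ℂ) (_ : IsUpperTriangular g),
            LinearMap.ker ((MvPolynomial.aeval (R := ℂ) fun p : MatIdx (n + 1) × MatIdx (n + 1) =>
              ∑ l : MatIdx (n + 1), ((g⁻¹ : Matrix.GeneralLinearGroup (MatIdx (n + 1)) ℂ) :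
                Matrix (MatIdx (n + 1)) (MatIdx (n + 1)) ℂ) p.1 l • MvPolynomial.X (l, p.2)).toLinearMap
              - weightChar χ g • LinearMap.id (R := ℂ) (M := MvPolynomial (MatIdx (n + 1) × MatIdx (n + 1)) ℂ)));
      T δ ≠ ⊥) := by
  intro U χ T h
  have hmem : (rename (fun i : MatIdx (n + 1) => ((matIdxEquiv (n + 1) (Fin.rev 0)), i)) (detFormLex ℂ (n + 1))) ^ δ ∈ T δ := cutBites_detRowLast_pow_mem_trunc_delta_of_odd n δ hm hδ
  rw [h, Submodule.mem_bot] at hmem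
  exact detRowLast_pow_ne_zero n δ hmem

end

end Summit.ValiantsHypothesis.ValiantsHypothesis.Theorems.CutBites.Negative
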